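import Summits.AtomisticToContinuum.HydrodynamicLimit.Theorems.ImplosionDichotomyHydroLimitInBandWindowEntropyInequality
import Summits.AtomisticToContinuum.HydrodynamicLimit.Theorems.JaynesSqueezeBlockGibbsToRelEntropyLedger
import Summits.AtomisticToContinuum.HydrodynamicLimit.Theorems.ImplosionDichotomyHydroLimitInBandWindowBalance
import Summits.AtomisticToContinuum.HydrodynamicLimit.Theorems.OneSphereInfluenceAssemblyMoments
import Literature.Analysis.FluidPDE.HardSphereFlowJointMeasurable
import HarnessLib

/-!
# The window entropy step of Yau's ledger (stub `stub_windowEntropyStep`, ES)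

Crux `Summit.AtomisticToContinuum.HydrodynamicLimit.Theses.OneFlightGossipEngine.ClampedCurrentsDock`
(stmt-AtomisticToContinuum-14680), line `IdeatorTwoSketch`, registered stub ES
`stub_windowEntropyStep : WindowEntropyStep` (the def re-declared verbatim from the line skeleton).

One channel of one window of the relative-entropy ledger: under the true law `λ_N = localGibbsLaw σ a₀ u₀ θ₀ N Φ`
started at time `0`, the window functional `Y(z) = Σ_i w⁻¹∫_s^{s+w} F(Φ_r z)_i dr + Yc(Φ_s z)` (streaming part with a
continuous `F` of quadratic velocity growth, collision part `Yc` bounded on the good set and agreeing there with a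
measurable `Ym`) is `λ_N`-integrable and `E_λ[Y] ≤ γ⁻¹ (KL(f_s ‖ ψ_N) + B)` as soon as the reference local Gibbs law
`ψ_N = localGibbsLaw σ b wv ϑ N Φ` carries `∫ exp(γ Y₀) dψ_N ≤ e^B`, `Y₀(z) = Σ_i w⁻¹∫₀^w F(Φ_r z)_i dr + Yc z`.

Proof: (1) flow property on the good set, `Y = Y₀ ∘ Φ_s` `λ_N`-a.e.
(`intervalIntegral.integral_comp_add_right`, `HardSphereFlow.flow_add`); (2) a MEASURABLE version `Ỹ₀` of `Y₀`
(`Measurable.dite` on the measurable good set, the streaming part measurable on the good subtype by the joint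
measurability of the flow, `HardSphereFlow.stronglyMeasurable_integral_comp_flow`); (3) transport
`E_λ[Ỹ₀ ∘ Φ_s] = E_{f_s}[Ỹ₀]`; (4) integrability from `|F| ≤ C(1 + |v|²)`, energy conservation along good orbits and
the Gaussian second moments at time `0` (`EntropyClockDock.integrable_sum_norm_sq_flow`); (5) finiteness
`JaynesSqueezeClosure.klDiv_lawAt_localGibbsLaw_ne_top`; (6) the entropy inequality
`EntropyClockDock.integral_le_inv_mul_toReal_klDiv_add`.

References: H.-T. Yau, Lett. Math. Phys. 22 (1991) 63–80, §2; C. Kipnis, C. Landim, *Scaling Limits of Interacting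
Particle Systems* (1999), App. 1 §8.
-/

noncomputable section

namespace Summit.AtomisticToContinuum.HydrodynamicLimit.Theorems.ClampedCurrentsDockEntropyStep

open scoped BigOperators ENNReal Classical Interval
open MeasureTheory Filter Set Topology InformationTheory
open Literature.MathematicalPhysics.KineticTheory Literature.Analysis.FluidPDE Literature.Analysis.FunctionSpaces
open Summit.AtomisticToContinuum.HydrodynamicLimit.Theorems
open Summit.AtomisticToContinuum.HydrodynamicLimit.Theorems.EntropyClockDock (ae_mem_good_localGibbsLaw
  ae_mem_good_lawAt integrable_sum_norm_sq_flow integral_le_inv_mul_toReal_klDiv_add)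
open Summit.AtomisticToContinuum.HydrodynamicLimit.Theorems.OneSphereInfluenceAssembly (sum_norm_vel_sq_flow)

/-! ## The statement (verbatim from the line skeleton) -/

/-- registered stub signature ES of line IdeatorTwoSketch, crux ClampedCurrentsDock — route-internal, not a cited fact -/
def WindowEntropyStep : Prop :=
  ∀ (σ : ℝ) (N : ℕ) (Φ : HardSphereFlow (Torus.geometry (Fin 3)) (hsDiameter σ N) (N + 1))
    (a₀ θ₀ : T3 → ℝ) (u₀ : T3 → V3) (b ϑ : T3 → ℝ) (wv : T3 → V3)
    (F : T3 × V3 → ℝ) (Yc Ym : Config (N + 1) (Fin 3) T3 → ℝ) (C M γ B s w : ℝ),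
    0 < σ → σ < 1 / 2 → Continuous a₀ → Continuous θ₀ → Continuous u₀ → (∀ x, 0 < a₀ x) → (∀ x, 0 < θ₀ x) →
    Continuous b → Continuous ϑ → Continuous wv → (∀ x, 0 < b x) → (∀ x, 0 < ϑ x) →
    Continuous F → (∀ y, |F y| ≤ C * (1 + ‖y.2‖ ^ 2)) → Measurable Ym → Set.EqOn Ym Yc Φ.good →
    (∀ z ∈ Φ.good, |Yc z| ≤ M) → 0 ≤ s → 0 < w → 0 < γ →
    ∫⁻ z, ENNReal.ofReal (Real.exp (γ * ((∑ i : Fin (N + 1), w⁻¹ * ∫ r in (0 : ℝ)..w, F (Φ.flow r z i)) + Yc z)))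
        ∂(localGibbsLaw σ b wv ϑ N Φ) ≤ ENNReal.ofReal (Real.exp B) →
    Integrable (fun z => (∑ i : Fin (N + 1), w⁻¹ * ∫ r in s..(s + w), F (Φ.flow r z i)) + Yc (Φ.flow s z))
        (localGibbsLaw σ a₀ u₀ θ₀ N Φ) ∧
      ∫ z, ((∑ i : Fin (N + 1), w⁻¹ * ∫ r in s..(s + w), F (Φ.flow r z i)) + Yc (Φ.flow s z))
          ∂(localGibbsLaw σ a₀ u₀ θ₀ N Φ) ≤
        γ⁻¹ * ((klDiv (Φ.lawAt (localGibbsLaw σ a₀ u₀ θ₀ N Φ) s) (localGibbsLaw σ b wv ϑ N Φ)).toReal + B)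

/-! ## Tools: measurability of window integrals on the good set, the pathwise bound, the window shift -/

section Tools

variable {ε : ℝ} {n : ℕ}

/-- A growth bound `|F y| ≤ C (1 + ‖v‖²)` at one point forces `C ≥ 0`. [folklore] -/
theorem nonneg_of_abs_le_mul_one_add_sq {F : T3 × V3 → ℝ} {C : ℝ}
    (hFC : ∀ y, |F y| ≤ C * (1 + ‖y.2‖ ^ 2)) (y : T3 × V3) : 0 ≤ C := by
  rcases le_or_gt 0 C with h | h
  · exact h
  · have h1 := hFC y
    nlinarith [abs_nonneg (F y), sq_nonneg ‖y.2‖, h1, h]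

/-- **Window integrals of a continuous one-particle observable along the flow are measurable on the good set**:
`z ↦ ∫_a^c F(Φ_r z)_i dr` is measurable on `Φ.good` (joint measurability of the flow on the good set,
`HardSphereFlow.measurable_flow_prod_torus`, and Fubini measurability `StronglyMeasurable.integral_prod_right'`, on the
two pieces `∫_{Ioc a c} − ∫_{Ioc c a}` of `intervalIntegral`; cf. `HardSphereFlow.stronglyMeasurable_integral_comp_flow`).
[folklore] -/
theorem measurable_intervalIntegral_comp_flow_apply (Φ : HardSphereFlow (Torus.geometry (Fin 3)) ε n)
    {F : T3 × V3 → ℝ} (hF : Continuous F) (i : Fin n) (a c : ℝ) :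
    Measurable fun z : Φ.good => ∫ r in a..c, F (Φ.flow r (z : Config n (Fin 3) T3) i) := by
  have hf : StronglyMeasurable fun z : Config n (Fin 3) T3 => F (z i) :=
    (hF.measurable.comp (measurable_pi_apply i)).stronglyMeasurable
  -- Fubini measurability after the joint measurability of the flow on `Φ.good × ℝ`
  have key : ∀ (ν : Measure ℝ) [SFinite ν],
      Measurable fun z : Φ.good => ∫ r, F (Φ.flow r (z : Config n (Fin 3) T3) i) ∂ν := fun ν _ =>
    ((hf.comp_measurable Φ.measurable_flow_prod_torus).integral_prod_right' (ν := ν)).measurable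
  simp only [intervalIntegral]
  exact (key _).sub (key _)

/-- **Pathwise bound on the window-averaged streaming functional** on a good orbit: with `|F| ≤ C (1 + ‖v‖²)`
and `w > 0`, `|Σ_i w⁻¹ ∫₀^w F(Φ_r z)_i dr| ≤ n C (1 + Σ_i ‖v_i‖²)` (pointwise bound on `Ι 0 w` through energy
conservation `OneSphereInfluenceAssembly.sum_norm_vel_sq_flow`, then
`intervalIntegral.norm_integral_le_of_norm_le_const`; no integrability of the integrand needed). [folklore] -/
theorem abs_sum_windowAverage_le (Φ : HardSphereFlow (Torus.geometry (Fin 3)) ε n) {F : T3 × V3 → ℝ} {C : ℝ}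
    (hC0 : 0 ≤ C) (hFC : ∀ y, |F y| ≤ C * (1 + ‖y.2‖ ^ 2)) {w : ℝ} (hw : 0 < w) {z : Config n (Fin 3) T3}
    (hz : z ∈ Φ.good) :
    |∑ i : Fin n, w⁻¹ * ∫ r in (0 : ℝ)..w, F (Φ.flow r z i)| ≤ (n : ℝ) * (C * (1 + ∑ i, ‖(z i).2‖ ^ 2)) := by
  have hi : ∀ i : Fin n, |w⁻¹ * ∫ r in (0 : ℝ)..w, F (Φ.flow r z i)| ≤ C * (1 + ∑ j, ‖(z j).2‖ ^ 2) := by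
    intro i
    have hK : ∀ r ∈ Ι (0 : ℝ) w, ‖F (Φ.flow r z i)‖ ≤ C * (1 + ∑ j, ‖(z j).2‖ ^ 2) := fun r _ => by
      rw [Real.norm_eq_abs]
      calc |F (Φ.flow r z i)| ≤ C * (1 + ‖(Φ.flow r z i).2‖ ^ 2) := hFC _
        _ ≤ C * (1 + ∑ j, ‖(Φ.flow r z j).2‖ ^ 2) := by
            gcongr
            exact Finset.single_le_sum (f := fun j => ‖(Φ.flow r z j).2‖ ^ 2) (fun j _ => sq_nonneg _)
              (Finset.mem_univ i)
        _ = C * (1 + ∑ j, ‖(z j).2‖ ^ 2) := by rw [sum_norm_vel_sq_flow Φ hz r]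
    have h := intervalIntegral.norm_integral_le_of_norm_le_const hK
    rw [sub_zero, abs_of_pos hw, Real.norm_eq_abs] at h
    rw [abs_mul, abs_of_pos (inv_pos.2 hw)]
    calc w⁻¹ * |∫ r in (0 : ℝ)..w, F (Φ.flow r z i)| ≤ w⁻¹ * (C * (1 + ∑ j, ‖(z j).2‖ ^ 2) * w) := by gcongr
      _ = C * (1 + ∑ j, ‖(z j).2‖ ^ 2) := by field_simp
  calc |∑ i : Fin n, w⁻¹ * ∫ r in (0 : ℝ)..w, F (Φ.flow r z i)|
      ≤ ∑ i : Fin n, |w⁻¹ * ∫ r in (0 : ℝ)..w, F (Φ.flow r z i)| := Finset.abs_sum_le_sum_abs _ _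
    _ ≤ ∑ _i : Fin n, C * (1 + ∑ j, ‖(z j).2‖ ^ 2) := Finset.sum_le_sum fun i _ => hi i
    _ = (n : ℝ) * (C * (1 + ∑ i, ‖(z i).2‖ ^ 2)) := by
      simp only [Finset.sum_const, Finset.card_univ, Fintype.card_fin, nsmul_eq_mul]

/-- **The window shift on a good orbit**: `∫_s^{s+w} F(Φ_r z)_i dr = ∫₀^w F(Φ_r (Φ_s z))_i dr` (group law
`Φ.flow_add` on the good set, translation of the integration variable). [folklore] -/
theorem intervalIntegral_shift_flow (Φ : HardSphereFlow (Torus.geometry (Fin 3)) ε n) (F : T3 × V3 → ℝ)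
    (i : Fin n) (s w : ℝ) {z : Config n (Fin 3) T3} (hz : z ∈ Φ.good) :
    ∫ r in s..(s + w), F (Φ.flow r z i) = ∫ r in (0 : ℝ)..w, F (Φ.flow r (Φ.flow s z) i) := by
  have h1 : ∀ r, Φ.flow r (Φ.flow s z) = Φ.flow (r + s) z := fun r => (Φ.flow_add r s z hz).symm
  simp_rw [h1]
  have h := intervalIntegral.integral_comp_add_right (fun r => F (Φ.flow r z i)) s (a := 0) (b := w)
  simp only [zero_add] at h
  rw [h, add_comm w s]

end Tools

/-! ## The stub -/

/-- **STUB `stub_windowEntropyStep`** (ES) of line `IdeatorTwoSketch` (crux `ClampedCurrentsDock`,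
stmt-AtomisticToContinuum-14680): Yau's entropy inequality for one channel of one window — flow property on the good
set, measurable version of the window functional, transport `E_λ[Ỹ₀ ∘ Φ_s] = E_{f_s}[Ỹ₀]`, integrability from
energy conservation and Gaussian moments at time `0`, finiteness of `KL(f_s ‖ ψ_N)`, and the entropy inequality with
the tilt `γ`. [cite: Yau1991, §2] -/
theorem stub_windowEntropyStep : WindowEntropyStep := by
  intro σ N Φ a₀ θ₀ u₀ b ϑ wv F Yc Ym C M γ B s w hσ hσ2 ha hθ hu ha0 hθ0 hb hϑ hwv hb0 hϑ0 hF hFC hYm hYmc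
    hYcM hs hw hγ hB
  set lam := localGibbsLaw σ a₀ u₀ θ₀ N Φ with hlam
  set psi := localGibbsLaw σ b wv ϑ N Φ with hpsi
  have hσ2' : σ ≤ 1 / 2 := hσ2.le
  haveI : IsProbabilityMeasure lam := isProbabilityMeasure_localGibbsLaw ha hθ hu ha0 hθ0 hσ2' N Φ
  haveI : IsProbabilityMeasure psi := isProbabilityMeasure_localGibbsLaw hb hϑ hwv hb0 hϑ0 hσ2' N Φ
  haveI : IsProbabilityMeasure (Φ.lawAt lam s) := by
    rw [HardSphereFlow.lawAt_eq]; exact Measure.isProbabilityMeasure_map (Φ.measurable_flow s).aemeasurable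
  have hgood : ∀ᵐ z ∂lam, z ∈ Φ.good := ae_mem_good_localGibbsLaw σ a₀ θ₀ u₀ N Φ
  have hgoodψ : ∀ᵐ z ∂psi, z ∈ Φ.good := ae_mem_good_localGibbsLaw σ b ϑ wv N Φ
  have hgood' : ∀ᵐ y ∂(Φ.lawAt lam s), y ∈ Φ.good := ae_mem_good_lawAt σ a₀ θ₀ u₀ N Φ s
  -- the window functional at the window start: raw streaming part `S0`, measurable version `St`, `Yt = St + Ym`
  set S0 : Config (N + 1) (Fin 3) T3 → ℝ := fun z =>
    ∑ i : Fin (N + 1), w⁻¹ * ∫ r in (0 : ℝ)..w, F (Φ.flow r z i) with hS0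
  set St : Config (N + 1) (Fin 3) T3 → ℝ := fun z => if z ∈ Φ.good then S0 z else 0 with hSt
  set Yt : Config (N + 1) (Fin 3) T3 → ℝ := fun z => St z + Ym z with hYt
  -- (2) measurability of the version
  have hSg : Measurable fun z : Φ.good => S0 (z : Config (N + 1) (Fin 3) T3) := by
    simp only [hS0]
    exact Finset.measurable_sum _ fun i _ =>
      (measurable_intervalIntegral_comp_flow_apply Φ hF i 0 w).const_mul _
  have hStm : Measurable St := Measurable.dite hSg measurable_const Φ.measurableSet_good
  have hYtm : Measurable Yt := hStm.add hYm
  -- on the good set the version is the raw functional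
  have hYt_eq : ∀ z ∈ Φ.good, Yt z = S0 z + Yc z := fun z hz => by
    simp only [hYt, hSt, if_pos hz, hYmc hz]
  -- (1) flow property: the window functional is `Yt ∘ Φ_s` almost surely under `λ_N`
  have hae : (fun z => (∑ i : Fin (N + 1), w⁻¹ * ∫ r in s..(s + w), F (Φ.flow r z i)) + Yc (Φ.flow s z))
      =ᵐ[lam] fun z => Yt (Φ.flow s z) := by
    filter_upwards [hgood] with z hz
    have hz' : Φ.flow s z ∈ Φ.good := Φ.mapsTo_good s hz
    rw [hYt_eq _ hz', hS0]
    congr 1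
    exact Finset.sum_congr rfl fun i _ => by rw [intervalIntegral_shift_flow Φ F i s w hz]
  -- (4) integrability of the version under `f_s`: domination by the conserved kinetic energy
  have hC0 : 0 ≤ C := nonneg_of_abs_le_mul_one_add_sq hFC (Classical.arbitrary _)
  set g : Config (N + 1) (Fin 3) T3 → ℝ := fun z =>
    ((N + 1 : ℕ) : ℝ) * (C * (1 + ∑ j, ‖(z j).2‖ ^ 2)) + M with hg
  have hgm : Measurable g := by
    simp only [hg]
    fun_prop
  have hgi : Integrable g (Φ.lawAt lam s) := by
    rw [HardSphereFlow.lawAt_eq]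
    refine (integrable_map_measure hgm.aestronglyMeasurable (Φ.measurable_flow s).aemeasurable).2 ?_
    have h1 := integrable_sum_norm_sq_flow ha hθ hu (fun x => (ha0 x).le) hθ0 σ N Φ s
    have h2 : Integrable (fun z => ((N + 1 : ℕ) : ℝ) * (C * (1 + ∑ j, ‖(Φ.flow s z j).2‖ ^ 2)) + M) lam :=
      ((((integrable_const (1 : ℝ)).add h1).const_mul C).const_mul _).add (integrable_const M)
    exact h2
  have hYti : Integrable Yt (Φ.lawAt lam s) := by
    refine hgi.mono' hYtm.aestronglyMeasurable ?_
    filter_upwards [hgood'] with z hz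
    rw [hYt_eq z hz, Real.norm_eq_abs, hg, hS0]
    exact (abs_add_le _ _).trans (add_le_add (abs_sum_windowAverage_le Φ hC0 hFC hw hz) (hYcM z hz))
  -- (3) transport: integrability and expectation of the window functional under `λ_N`
  have hYlam : Integrable (fun z => Yt (Φ.flow s z)) lam := by
    have h := hYti
    rw [HardSphereFlow.lawAt_eq] at h
    exact (integrable_map_measure hYtm.aestronglyMeasurable (Φ.measurable_flow s).aemeasurable).1 h
  have hYint : Integrable
      (fun z => (∑ i : Fin (N + 1), w⁻¹ * ∫ r in s..(s + w), F (Φ.flow r z i)) + Yc (Φ.flow s z)) lam :=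
    hYlam.congr hae.symm
  have hint : ∫ z, ((∑ i : Fin (N + 1), w⁻¹ * ∫ r in s..(s + w), F (Φ.flow r z i)) + Yc (Φ.flow s z)) ∂lam =
      ∫ z, Yt z ∂(Φ.lawAt lam s) := by
    rw [integral_congr_ae hae, HardSphereFlow.lawAt_eq,
      integral_map (Φ.measurable_flow s).aemeasurable hYtm.aestronglyMeasurable]
  -- (5) finiteness of the relative entropy
  have hfin : klDiv (Φ.lawAt lam s) psi ≠ ⊤ :=
    JaynesSqueezeClosure.klDiv_lawAt_localGibbsLaw_ne_top hσ2' ha hθ hu ha0 hθ0 hb hϑ hwv hb0 hϑ0 N Φ s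
  -- (6) the exponential moment of the version under `ψ_N` (carried by the good set)
  have hB' : ∫⁻ z, ENNReal.ofReal (Real.exp (γ * Yt z)) ∂psi ≤ ENNReal.ofReal (Real.exp B) := by
    refine le_of_eq_of_le (lintegral_congr_ae ?_) hB
    filter_upwards [hgoodψ] with z hz
    rw [hYt_eq z hz]
  -- (7) the entropy inequality
  have hEI := integral_le_inv_mul_toReal_klDiv_add (μ := Φ.lawAt lam s) (ν := psi) hfin hYtm hYti hγ hB'
  refine ⟨hYint, ?_⟩
  rw [hint]
  exact hEI

end Summit.AtomisticToContinuum.HydrodynamicLimit.Theorems.ClampedCurrentsDockEntropyStep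

end
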